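import Literature.NumberTheory.EllipticCurves.TowerSaturatedAnnihilatorProofs
import Literature.NumberTheory.GaloisRepresentations.CohomologicalDimension
import HarnessLib

/-!
# Saturated level conditions for a TORSION limit: when the towers are uniformly killed by `p^c`, every
# compatible family is saturated and the exact-orthogonal-complement descent needs only (Iso) + (Dual)
# (the shape of Howard's H.4 at the places `v ∣ N`, where `H¹(K_v, T_𝔮)` is finite)

`Proofs` file in the currency of the tree's abstract towers `Literature.NumberTheory.EllipticCurves.Tower.*`
(companion of `TowerSaturatedAnnihilatorProofs.lean`); theorems only — no definition, no named fact, no instance,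
no `sorry`.

At a place `v ∣ N` (`v ∤ p`) of Howard's setting the local cohomology `H¹(K_v, T_𝔮) = lim_j H¹(K_v, T_𝔮/𝔪^j)` is
FINITE (`H¹(K_v, V_𝔮) = 0` by the local Euler characteristic at `v ∤ p`, Milne I 2.8, once `H⁰(K_v, V_𝔮) = 0 =
H⁰(K_v, V_𝔮^*(1))`), i.e. the level groups `X_j` are `p`-primary of bounded order.  Then:

* `§1` a finite `p`-primary group of order `≤ c` is killed by `p^c` (`nsmul_eq_zero_of_isPrimaryTorsion_of_natCard_le`);
* `§2` if every level is killed by `p^c`, EVERY compatible family is saturated for EVERY family of cores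
  (`saturatedFamilies_eq_compatibleFamilies_of_forall_nsmul_eq_zero`, `levelCondition_eq_levelCondition_top`): the
  propagated condition is the full group of liftable classes, whatever the cores — for `H¹(K_v, T_𝔮)` torsion this is
  «`F_𝔮` at `v ∣ N` is all of (the image of) `H¹(K_v, T_𝔮)`»;
* `§3` the exactness input (Exact) of `Tower.mem_levelCondition_of_forall_pairing_eq_zero` holds TRIVIALLY
  (`hExact_of_forall_nsmul_eq_zero`, with `η′ = 0`), so the two `↔` clauses of `DualityDatum.IsSelfOrthogonalAt` for the
  level conditions follow from reduction-compatible level pairings, levelwise core isotropy (Iso) and the duality input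
  (Dual) alone (**`levelCondition_mem_iff_forall_pairing_eq_zero_of_forall_nsmul_eq_zero`**) — (Iso) for unramified cores:
  `Howard2004/UnramifiedIsotropy`; (Dual): `TowerLiftableOfDualityProofs` + `TowerKummerLiftProofs`.

Cell `pub/bsd-print-x9` (Howard H.4 at `v ∣ N`); nothing arithmetic is proved here; BSD is not proved by any of this.

References: [Howard2004HeegnerKolyvagin] B. Howard, Compositio Math. 140 (2004), §1.3 H.4, Def. 3.1.2 / 3.2.6
(arXiv:1202.6340 p. 7 L78–82, pp. 15–16); [MilneADT2006] I Cor. 2.3, Thm. 2.8; [MazurRubinMemoirs2004] §1.3,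
Lemma 3.7.1.
-/

noncomputable section

universe u v w

namespace Literature.NumberTheory.EllipticCurves

open Literature.NumberTheory.GaloisRepresentations

namespace Tower

/-! ## §1 Bounded `p`-primary groups are uniformly torsion -/

/-- A finite `p`-primary abelian group of order `≤ c` is killed by `p^c` (the order `p^a` of an element is `≤ c`,
so `a ≤ c`). [cite: MilneADT2006, Ch. I §2 (finite local cohomology groups)] -/
theorem nsmul_eq_zero_of_isPrimaryTorsion_of_natCard_le {M : Type u} [AddCommGroup M] [Finite M] {p c : ℕ}
    (hp : p.Prime) (hM : IsPrimaryTorsion p M) (hc : Nat.card M ≤ c) (y : M) : p ^ c • y = 0 := by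
  classical
  haveI : Fintype M := Fintype.ofFinite M
  obtain ⟨r, hr⟩ := hM y
  -- the additive order of `y` is a power `p^a` dividing `p^r`, with `p^a ≤ #M ≤ c`, hence `a ≤ c`
  have hdvd : addOrderOf y ∣ p ^ r := addOrderOf_dvd_of_nsmul_eq_zero hr
  obtain ⟨a, -, ha⟩ := (Nat.dvd_prime_pow hp).1 hdvd
  have hle : p ^ a ≤ c := by
    rw [← ha]
    exact (addOrderOf_le_card_univ (x := y)).trans (by rw [← Nat.card_eq_fintype_card]; exact hc)
  have hac : a ≤ c := (Nat.lt_pow_self hp.one_lt).le.trans hle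
  obtain ⟨d, hd⟩ := Nat.exists_eq_add_of_le hac
  rw [hd, pow_add, mul_comm, mul_smul, ← ha, addOrderOf_nsmul_eq_zero, smul_zero]

/-! ## §2 Uniformly torsion towers: every compatible family is saturated -/

variable {X : ℕ → Type u} [∀ j, AddCommGroup (X j)] (red : ∀ j, X (j + 1) →+ X j)
variable {Y : ℕ → Type v} [∀ j, AddCommGroup (Y j)] (red' : ∀ j, Y (j + 1) →+ Y j)

/-- If every level is killed by `p^c`, every compatible family is saturated, for EVERY family of cores.
[cite: Howard2004HeegnerKolyvagin, Def. 1.1.1 / Def. 3.1.2 (arXiv p. 5: propagation from V; p. 15)] -/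
theorem saturatedFamilies_eq_compatibleFamilies_of_forall_nsmul_eq_zero (p : ℕ) (C : ∀ j, AddSubgroup (X j))
    {c : ℕ} (hX : ∀ j (x : X j), p ^ c • x = 0) :
    saturatedFamilies red p C = compatibleFamilies red := by
  refine le_antisymm (saturatedFamilies_le_compatibleFamilies red p C) fun x hx => ?_
  exact mem_saturatedFamilies_of_nsmul_eq_zero red p C hx (b := c) (funext fun j => by
    rw [Pi.smul_apply, Pi.zero_apply, hX])

/-- Hence every level condition is the TOP one (the liftable classes), whatever the cores.
[cite: Howard2004HeegnerKolyvagin, Def. 1.1.1 / Def. 3.1.2 (arXiv pp. 5, 15)] -/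
theorem levelCondition_eq_levelCondition_top (p : ℕ) (C : ∀ j, AddSubgroup (X j)) {c : ℕ}
    (hX : ∀ j (x : X j), p ^ c • x = 0) (k : ℕ) :
    levelCondition red p C k = levelCondition red p (fun j => (⊤ : AddSubgroup (X j))) k := by
  unfold levelCondition
  rw [saturatedFamilies_eq_compatibleFamilies_of_forall_nsmul_eq_zero red p C hX,
    saturatedFamilies_eq_compatibleFamilies_of_forall_nsmul_eq_zero red p _ hX]

/-! ## §3 (Exact) is trivial for a torsion limit; the descent from (Iso) + (Dual) alone -/

/-- The exactness input (Exact) of `mem_levelCondition_of_forall_pairing_eq_zero` holds trivially when the `Y`-tower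
is uniformly torsion: every compatible family of `Y` is saturated (take `η′ = 0`).
[cite: Howard2004HeegnerKolyvagin, §1.3 H.4 and Def. 3.2.6 (arXiv p. 7 L78–82, p. 16)] -/
theorem hExact_of_forall_nsmul_eq_zero {Qk : Type w} [AddCommGroup Qk] (p : ℕ) (C : ∀ j, AddSubgroup (X j))
    (C' : ∀ j, AddSubgroup (Y j)) (k : ℕ) (B : X k →+ Y k →+ Qk) (n : ℕ) {c : ℕ}
    (hY : ∀ j (y : Y j), p ^ c • y = 0) :
    ∀ η ∈ compatibleFamilies red', (∀ ξ ∈ saturatedFamilies red p C, B (ξ k) (η k) = 0) →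
      ∃ η' : Π j, Y j, η - n • η' ∈ saturatedFamilies red' p C' := by
  intro η hη _
  refine ⟨0, ?_⟩
  rw [smul_zero, sub_zero, saturatedFamilies_eq_compatibleFamilies_of_forall_nsmul_eq_zero red' p C' hY]
  exact hη

variable {Q : ℕ → Type w} [∀ j, AddCommGroup (Q j)] (redQ : ∀ j, Q (j + 1) →+ Q j) (B : ∀ j, X j →+ Y j →+ Q j)

/-- **Exact orthogonal complements for uniformly torsion towers** (Howard's H.4 at `v ∣ N`, abstractly): if both
towers are killed by `p^c` at every level, the two `↔` clauses of `DualityDatum.IsSelfOrthogonalAt` for the level-`k`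
conditions follow from reduction-compatible level pairings into a value tower with torsion-free limit (`hB`, `hQ`),
levelwise ISOTROPY of the cores (`hC`) and the DUALITY inputs (`hDualX`, `hDualY`: a class orthogonal to the bottom
condition lifts to a compatible family) — the exactness inputs of `levelCondition_mem_iff_forall_pairing_eq_zero`
being automatic (`hExact_of_forall_nsmul_eq_zero`).
[cite: Howard2004HeegnerKolyvagin, §1.3 H.4 and Def. 3.2.6 (arXiv p. 7 L78–82, p. 16)] [cite: MilneADT2006, Ch. I Cor. 2.3] -/
theorem levelCondition_mem_iff_forall_pairing_eq_zero_of_forall_nsmul_eq_zero (p : ℕ) (C : ∀ j, AddSubgroup (X j))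
    (C' : ∀ j, AddSubgroup (Y j))
    (hB : ∀ j (x : X (j + 1)) (y : Y (j + 1)), redQ j (B (j + 1) x y) = B j (red j x) (red' j y))
    (hQ : ∀ j (q : Q (j + 1)), p • q = 0 → redQ j q = 0)
    (hC : ∀ j, ∀ c ∈ C j, ∀ c' ∈ C' j, B j c c' = 0)
    (k : ℕ) {c : ℕ} (hTX : ∀ j (x : X j), p ^ c • x = 0) (hTY : ∀ j (y : Y j), p ^ c • y = 0)
    (hDualY : ∀ y : Y k, (∀ x ∈ levelCondition red p (fun _ => (⊥ : AddSubgroup (X _))) k, B k x y = 0) →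
      y ∈ levelCondition red' p (fun _ => (⊤ : AddSubgroup (Y _))) k)
    (hDualX : ∀ x : X k, (∀ y ∈ levelCondition red' p (fun _ => (⊥ : AddSubgroup (Y _))) k, B k x y = 0) →
      x ∈ levelCondition red p (fun _ => (⊤ : AddSubgroup (X _))) k) :
    (∀ x : X k, x ∈ levelCondition red p C k ↔ ∀ y ∈ levelCondition red' p C' k, B k x y = 0) ∧
      ∀ y : Y k, y ∈ levelCondition red' p C' k ↔ ∀ x ∈ levelCondition red p C k, B k x y = 0 :=
  levelCondition_mem_iff_forall_pairing_eq_zero red red' redQ B p C C' hB hQ hC k (p ^ c) (hTX k) (hTY k) hDualY hDualX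
    (hExact_of_forall_nsmul_eq_zero red red' p C C' k (B k) (p ^ c) hTY)
    (fun ξ hξ hξ0 => hExact_of_forall_nsmul_eq_zero red' red p C' C k (B k).flip (p ^ c) hTX ξ hξ fun η hη => by
      simpa only [AddMonoidHom.flip_apply] using hξ0 η hη)

end Tower

end Literature.NumberTheory.EllipticCurves
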